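import Summits.BirchSwinnertonDyer.BirchSwinnertonDyer.Theorems.QuadraticBranchSignedControlPlusEtaNonsurjUnitRows
import Summits.BirchSwinnertonDyer.BirchSwinnertonDyer.Theorems.QuadraticBranchSignedControlPlusEtaNonsurjMuSaturation
import HarnessLib

/-!
# Route `QuadraticBranchSignedControl` (rung K8, cell `bsd-potss`), residual crux
# `PlusEtaMainConjectureNonsurj` (stmt-BirchSwinnertonDyer-19606): the `μ`-AMBIGUITY of Kobayashi's
# Thm. 4.1 at `η` IS BOUNDED BY THE BOTTOM LAYER — `pᵏ ∣ char(X⁺(V/K_∞)^η) ⟹ k ≤ ord_p #Sel_{p^∞}(W/ℚ)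
# + ord_p Tam(W)` on every analytic-rank-`0` row, Poitou–Tate-free (seat `bsd-potss-k8eta-c2` g2)

WHAT. By `…PlusEtaNonsurjMuSaturation` (this seat) the literature-gap binder of crux 19606 on its
rank-`0` rows — the INTEGRAL inclusion `(L_p⁺(V,η,X)) ⊆ Char(X⁺(V/K_∞)^η)` — is the statement
`μ(X⁺(V/K_∞)^η) = 0`. This file bounds that `μ` from the bottom layer alone: for the additive partner
`W` (`C • W^{(p*)} = V`, `p ≥ 5`, `Sel_{p^∞}(W/ℚ)` finite) and ANY characteristic generator `g` of ANY
plus dual datum (of `W` over `ℚ_∞`, equivalently of `V` over `K_∞` at `η`),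

  `v_p(g(0)) ≤ ord_p #Sel_{p^∞}(W/ℚ) + ord_p Tam(W)`, hence `pᵏ ∣ g ⟹ k ≤ ord_p #Sel_{p^∞}(W/ℚ) + ord_p Tam(W)`

— `X` is torsion with `g(0) ≠ 0` (`…PlusEtaBottomLayerFinite`), `v_p(g(0)) ≤ ord_p #A₀⁺` (ctrl g2's
`hnf`-free `EvenControlZero.valuation_constantCoeff_le_padicValNat_card_localPreimage`, Greenberg's
Lemma 4.2 with `X[T]` kept), `#A₀⁺ = #Sel⁺(W/ℚ_0)·[A₀⁺ : Sel⁺(W/ℚ_0)]`, `#Sel⁺(W/ℚ_0) = #Sel_{p^∞}(W/ℚ)`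
and `ord_p [A₀⁺ : Sel⁺(W/ℚ_0)] ≤ ∑_{v ≠ p} ord_p c_v(W) = ord_p Tam(W)` ((L0⁺) = Kobayashi's (9.33) +
Greenberg's Lemma 3.3; `c_p(W) ≤ 4 < p`). NO Poitou–Tate, NO Kitajima–Otsuki, NO Thm. 2.2 / 4.1, NO
image hypothesis. So on a rank-`0` row the slack `pⁿ` of Thm. 4.1 at `η` that the main conjecture has to
absorb is at most `p^{ord_p(#Ш(W)[p^∞]·Tam(W))}`; on the unit rows it is `p⁰` (and there
`…PlusEtaNonsurjUnitRows` proves the conjecture outright).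

* §1 (`W`-side) `valuation_charGenerator_le_selmer_add_tamagawa`, `le_of_C_pow_dvd_charGenerator`,
  `hasUnitContent_charGenerator_of_selmer_trivial_of_not_dvd_tamagawa`.
* §2 (`η`-side, through ctrl g4's (D5⁺)⁻¹) `eta_le_of_C_pow_dvd_charGenerator` — for every `η`-datum of
  `V` over an abstract `ℚ(μ_p)`.

HONEST FRAMING (cell `bsd-potss`, run/shared/lean/pub/bsd-potss/; FULL-BSD rank ≤ 1 programme,
tranche 1b, HUMAN RULING D-0036/D-0074): TOOL THEOREMS ONLY — no definition, no named Literature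
fact, no Summits-side `def … : Prop`, no `sorry`, axioms standard; UNCONDITIONAL (the per-row input
`Sel_{p^∞}(W/ℚ)` finite is a displayed binder — GZK supplies it when `L(W,1) ≠ 0`). Nothing about
(C1⁺_η) / `BSD(W,p)` is claimed; the crux 19606 stays OPEN; nothing is booked; no label / mark / count
moves. `--supports stmt-BirchSwinnertonDyer-19606`.

References: [Kobayashi2003] Thm. 4.1 (p. 8), Lemma 9.1 (p. 25), Thm. 9.3 with (9.33) (pp. 26–27);
[GreenbergLNM1716] §3 Lemma 3.3 (pp. 86–88), §4 Thm. 4.1 and Lemma 4.2 (p. 102);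
[CoatesSchneiderSujatha2003] §3 (30)–(31); [GreenbergVatsal2000] p. 2 (2); [Washington1997] §13.2.
-/

set_option autoImplicit false
set_option linter.dupNamespace false

noncomputable section

open scoped Classical

open CongruenceSubgroup Field Function NumberField IsDedekindDomain WeierstrassCurve
open Literature.NumberTheory.EllipticCurves
open Literature.NumberTheory.EllipticCurves.ModularForms
open Literature.NumberTheory.EllipticCurves.Rank1Residual
open Literature.NumberTheory.EllipticCurves.Rank1Residual.Typed
open Literature.NumberTheory.GaloisRepresentations
open Literature.NumberTheory.GaloisCohomology
open Literature.NumberTheory.EllipticCurves.IwasawaAlgebra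
open Literature.NumberTheory.EllipticCurves.IwasawaDual ZpExtension
open Literature.NumberTheory.EllipticCurves.GreenbergVatsal2000
open Summit.BirchSwinnertonDyer.Rank1Residual.X11b.Levels
open Summit.BirchSwinnertonDyer.Rank1Residual.X11b
open Summit.BirchSwinnertonDyer.Rank1Residual.Additive
open Summit.BirchSwinnertonDyer.Rank1Residual.Additive.SignedTwist
open scoped ContRepresentation
open Summit.BirchSwinnertonDyer.Rank1Residual.AdditivePotMult

namespace Summit.BirchSwinnertonDyer.BirchSwinnertonDyer.Theorems

namespace EtaMuBound

/-! ## §1 `W`-side: `v_p(g(0)) ≤ ord_p #Sel_{p^∞}(W/ℚ) + ord_p Tam(W)`, Poitou–Tate-free -/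

section Twist

variable {p : ℕ} [hp : Fact p.Prime] (κ : ZpExtension ℚ p) (W : WeierstrassCurve ℚ) [W.IsElliptic]
  [W.IsGloballyMinimal]

/-- **`v_p(g(0)) ≤ ord_p #Sel_{p^∞}(W/ℚ) + ord_p Tam(W)` for EVERY characteristic generator `g` of EVERY
plus dual datum `D` of `Sel⁺(W/ℚ_∞)`** — `W` globally minimal the `p*`-twist of a globally minimal good
`a_p = 0` curve `V`, `p ≥ 5`, `κ` cyclotomic with topological generator `γ`, `Sel_{p^∞}(W/ℚ)` FINITE.
`X` is torsion with `g(0) ≠ 0` (`EtaBottomLayer.isTorsion_and_constantCoeff_ne_zero_of_finite_selmer`);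
`v_p(g(0)) ≤ ord_p #A₀⁺` (Greenberg's Lemma 4.2 with `X[T]` kept, ctrl g2); Lagrange
`#A₀⁺ = #(A₀⁺⧸Sel⁺(W/ℚ_0))·#Sel⁺(W/ℚ_0)`, `#Sel⁺(W/ℚ_0) = #Sel_{p^∞}(W/ℚ)`, and
`ord_p #(A₀⁺⧸Sel⁺(W/ℚ_0)) ≤ ∑_{v ≠ p} ord_p c_v(W) = ord_p Tam(W)` ((L0⁺) + Greenberg's Lemma 3.3;
`c_p(W) ≤ 4 < p`). NO Poitou–Tate, NO Kitajima–Otsuki, NO Thm. 2.2 / 4.1.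
[cite: GreenbergLNM1716, §3 Lemma 3.3 (pp. 86–88), §4 Lemma 4.2 (p. 102)] [cite: Kobayashi2003, Thm. 9.3 with (9.33) (pp. 26–27)]
[cite: CoatesSchneiderSujatha2003, §3 (30)–(31)] -/
theorem valuation_charGenerator_le_selmer_add_tamagawa (hp5 : 5 ≤ p) (hκ : κ.IsCyclotomic)
    (C : VariableChange ℚ) (V : WeierstrassCurve ℚ) [V.IsElliptic] [V.IsGloballyMinimal]
    (hCV : C • W.quadraticTwist ((-1) ^ (p / 2) * p) = V)
    (hgood : V.HasGoodReductionAtPrime p) (hap : V.frobeniusTrace p = 0)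
    {γ : Field.absoluteGaloisGroup ℚ} (hγ : κ.IsTopGenerator γ)
    [Finite ↥(W.selmerGroupPInfty p)] (D : StrictSignedSelmerDualData W κ ℚ_[p] γ 1)
    {g : IwasawaAlgebra p} (hg : D.charIdeal = Ideal.span {g}) :
    PowerSeries.constantCoeff g ≠ 0 ∧
      ((PowerSeries.constantCoeff g : ℤ_[p]) : ℚ_[p]).valuation ≤
        (padicValNat p (Nat.card ↥(W.selmerGroupPInfty p)) : ℤ) + padicValNat p W.tamagawaProduct := by
  have hp2 : p ≠ 2 := by omega
  set v₀ := (Rat.HeightOneSpectrum.primesEquiv (R := 𝓞 ℚ)).symm ⟨p, hp.out⟩ with hv₀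
  obtain ⟨hfg, htor, hall⟩ :=
    EtaBottomLayer.isTorsion_and_constantCoeff_ne_zero_of_finite_selmer κ W hp2 hκ C V hCV hgood hap hγ D
  haveI := hfg
  have h0 : PowerSeries.constantCoeff g ≠ 0 := (hall g hg).2
  refine ⟨h0, ?_⟩
  -- `A₀⁺` finite and `v_p(g(0)) ≤ ord_p #A₀⁺`
  set A := (W.selmerInfty κ ⊓
      ⨅ σ : Field.absoluteGaloisGroup ℚ,
        (Kobayashi2003.localKummerOverOfEmb W p κ.kerSubgroup (closureEmb (K := ℚ) ℚ_[p])
            (⨆ m, strictSignedLocalPoints κ ℚ_[p] W 1 m)).comap (W.conjH1 p κ.kerSubgroup σ)).comap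
      (W.layerToInfty κ 0) with hAdef
  haveI hfinA : Finite A := EtaBottomLayer.finite_localPreimage_of_finite_selmer κ W hp2 hκ C V hCV hgood hap
  have hvA := EvenControlZero.valuation_constantCoeff_le_padicValNat_card_localPreimage κ W 1 hp2 C V hCV hgood
    hap hγ D htor hg h0
  -- Lagrange: `#A₀⁺ = #(A₀⁺⧸S₀)·#S₀`, `#S₀ = #Sel_{p^∞}(W/ℚ)`
  set S0 := strictSignedSelmerLayer W κ ℚ_[p] 1 0 with hS0
  have hle : S0 ≤ A := EtaBottomLayer.layer_le_localPreimage κ W hp2 C V hCV hgood hap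
  have hcardS := StrictSignedLayerZero.natCard_strictSignedSelmerLayer_one_zero_eq_selmerGroupPInfty W κ
  have hLag : Nat.card A = Nat.card (A ⧸ S0.addSubgroupOf A) * Nat.card ↥(W.selmerGroupPInfty p) := by
    rw [← hcardS, ← Nat.card_congr (AddSubgroup.addSubgroupOfEquivOfLe hle).toEquiv]
    exact AddSubgroup.card_eq_card_quotient_mul_card_addSubgroup _
  have hqpos : Nat.card (A ⧸ S0.addSubgroupOf A) ≠ 0 := Nat.card_pos.ne'
  have hSelpos : Nat.card ↥(W.selmerGroupPInfty p) ≠ 0 := Nat.card_pos.ne'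
  have hordA : padicValNat p (Nat.card A) =
      padicValNat p (Nat.card (A ⧸ S0.addSubgroupOf A)) + padicValNat p (Nat.card ↥(W.selmerGroupPInfty p)) := by
    rw [hLag, padicValNat.mul hqpos hSelpos]
  -- the defect is bounded by the Tamagawa exponents away from `p` ((L0⁺) + Greenberg's Lemma 3.3)
  obtain ⟨S, hS⟩ := exists_finset_forall_not_mem_good W p
  have hloc := evenBranchPlusLocalControlZeroAt_holds W p V C hp2 hCV hgood hap κ hκ
  have hdef := StrictSignedControlZero.padicValNat_card_quotient_le_sum_of_loc W κ 1 hκ S hS hloc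
  -- bookkeeping: `∑_{v ∈ S, v ∤ p} ord_p c_v = ord_p Tam(W)`
  set T := S.filter (fun v ↦ (p : 𝓞 ℚ) ∉ v.asIdeal) with hT
  have hv₀p : (p : 𝓞 ℚ) ∈ v₀.asIdeal := (natCast_mem_asIdeal_iff_eq_primesEquiv_symm v₀ hp.out).mpr rfl
  have hpT : v₀ ∉ T := fun h ↦ (Finset.mem_filter.mp h).2 hv₀p
  have hTmem : ∀ v : HeightOneSpectrum (𝓞 ℚ), v ≠ v₀ →
      p ∣ (W.baseChange (v.adicCompletion ℚ)).localTamagawaNumber (v.adicCompletionIntegers ℚ) → v ∈ T := by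
    intro v hv hdvd
    refine Finset.mem_filter.mpr ⟨?_, fun hpv ↦ hv ((natCast_mem_asIdeal_iff_eq_primesEquiv_symm v hp.out).mp hpv)⟩
    by_contra hvS
    rw [W.localTamagawaNumber_eq_one_of_hasGoodReductionAt_holds v (hS v hvS).2] at hdvd
    exact hp.out.one_lt.ne' (Nat.dvd_one.mp hdvd)
  have hc0 := LevelBridge.padicValNat_localTamagawaNumber_eq_zero_of_quadraticTwist_signedPrime W p hp5 C V
    hCV hgood
  have hTamSum := LevelBridge.sum_padicValNat_localTamagawaNumber_eq_padicValNat_tamagawaProduct W p T hpT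
    hTmem hc0
  rw [hTamSum] at hdef
  -- assemble
  have h1 : (padicValNat p (Nat.card A) : ℤ) ≤
      (padicValNat p (Nat.card ↥(W.selmerGroupPInfty p)) : ℤ) + padicValNat p W.tamagawaProduct := by
    rw [hordA]; push_cast; linarith [(Nat.cast_le (α := ℤ)).mpr hdef]
  exact hvA.trans h1

/-- **`pᵏ ∣ g ⟹ k ≤ ord_p #Sel_{p^∞}(W/ℚ) + ord_p Tam(W)`** for every characteristic generator `g` of
every plus dual datum of `Sel⁺(W/ℚ_∞)` (hypotheses as in
`valuation_charGenerator_le_selmer_add_tamagawa`): `g = pᵏ·h` gives `v_p(g(0)) = k + v_p(h(0)) ≥ k`.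
In Greenberg–Vatsal's reading (2) of the `μ`-invariant: **`μ(X⁺_W(ℚ_∞)) ≤ ord_p(#Ш(W)[p^∞]·Tam(W))`**
in analytic rank `0` — the `μ`-ambiguity `pⁿ` of Kobayashi's Thm. 4.1 at `η` that the even main
conjecture must absorb on a NON-onto row is bounded by the bottom layer.
[cite: GreenbergVatsal2000, p. 2 (2)] [cite: GreenbergLNM1716, §4 Lemma 4.2 (p. 102)] [cite: Kobayashi2003, Thm. 4.1 (p. 8)] -/
theorem le_of_C_pow_dvd_charGenerator (hp5 : 5 ≤ p) (hκ : κ.IsCyclotomic)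
    (C : VariableChange ℚ) (V : WeierstrassCurve ℚ) [V.IsElliptic] [V.IsGloballyMinimal]
    (hCV : C • W.quadraticTwist ((-1) ^ (p / 2) * p) = V)
    (hgood : V.HasGoodReductionAtPrime p) (hap : V.frobeniusTrace p = 0)
    {γ : Field.absoluteGaloisGroup ℚ} (hγ : κ.IsTopGenerator γ)
    [Finite ↥(W.selmerGroupPInfty p)] (D : StrictSignedSelmerDualData W κ ℚ_[p] γ 1)
    {g : IwasawaAlgebra p} (hg : D.charIdeal = Ideal.span {g}) {k : ℕ}
    (hk : PowerSeries.C ((p : ℤ_[p]) ^ k) ∣ g) :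
    (k : ℤ) ≤ (padicValNat p (Nat.card ↥(W.selmerGroupPInfty p)) : ℤ) + padicValNat p W.tamagawaProduct := by
  obtain ⟨h0, hle⟩ := valuation_charGenerator_le_selmer_add_tamagawa κ W hp5 hκ C V hCV hgood hap hγ D hg
  obtain ⟨h, rfl⟩ := hk
  have hmul : PowerSeries.constantCoeff (PowerSeries.C ((p : ℤ_[p]) ^ k) * h) =
      (p : ℤ_[p]) ^ k * PowerSeries.constantCoeff h := by
    rw [map_mul, PowerSeries.constantCoeff_C]
  have hh0 : PowerSeries.constantCoeff h ≠ 0 := fun hz ↦ h0 (by rw [hmul, hz, mul_zero])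
  have hh0' : ((PowerSeries.constantCoeff h : ℤ_[p]) : ℚ_[p]) ≠ 0 := by
    rw [Ne, PadicInt.coe_eq_zero]; exact hh0
  have hpk : ((p : ℚ_[p]) ^ k) ≠ 0 := pow_ne_zero _ (Nat.cast_ne_zero.mpr hp.out.ne_zero)
  have hval : ((PowerSeries.constantCoeff (PowerSeries.C ((p : ℤ_[p]) ^ k) * h) : ℤ_[p]) : ℚ_[p]).valuation =
      (k : ℤ) + ((PowerSeries.constantCoeff h : ℤ_[p]) : ℚ_[p]).valuation := by
    rw [hmul, PadicInt.coe_mul, PadicInt.coe_pow, PadicInt.coe_natCast, Padic.valuation_mul hpk hh0',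
      Padic.valuation_pow, Padic.valuation_p, mul_one]
  have hnn : (0 : ℤ) ≤ ((PowerSeries.constantCoeff h : ℤ_[p]) : ℚ_[p]).valuation := by
    rw [PadicInt.valuation_coe]; exact_mod_cast Nat.zero_le _
  rw [hval] at hle
  linarith

/-- **The unit rows: `Sel_{p^∞}(W/ℚ) = 0` and `p ∤ Tam(W)` ⟹ every characteristic generator of every plus
dual datum has UNIT CONTENT (`μ = 0`)** — the case `k = 1` of `le_of_C_pow_dvd_charGenerator`
(Greenberg–Vatsal: `HasUnitContent g ↔ p ∤ g`). (On these rows `…PlusEtaBottomLayerTrivial` gives the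
stronger `X⁺ = 0`; this is the `μ`-currency form consumed by `…PlusEtaNonsurjMuSaturation`.)
[cite: GreenbergVatsal2000, p. 2 (2)] [cite: GreenbergLNM1716, §3 Prop. 3.8, §4 Lemma 4.2] -/
theorem hasUnitContent_charGenerator_of_selmer_trivial_of_not_dvd_tamagawa (hp5 : 5 ≤ p)
    (hκ : κ.IsCyclotomic) (C : VariableChange ℚ) (V : WeierstrassCurve ℚ) [V.IsElliptic]
    [V.IsGloballyMinimal] (hCV : C • W.quadraticTwist ((-1) ^ (p / 2) * p) = V)
    (hgood : V.HasGoodReductionAtPrime p) (hap : V.frobeniusTrace p = 0)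
    {γ : Field.absoluteGaloisGroup ℚ} (hγ : κ.IsTopGenerator γ)
    (hSel : W.selmerGroupPInfty p = ⊥) (hTam : ¬ p ∣ W.tamagawaProduct)
    (D : StrictSignedSelmerDualData W κ ℚ_[p] γ 1)
    {g : IwasawaAlgebra p} (hg : D.charIdeal = Ideal.span {g}) : HasUnitContent g := by
  haveI : Finite ↥(W.selmerGroupPInfty p) := by rw [hSel]; infer_instance
  rw [hasUnitContent_iff_not_C_dvd]
  intro hdvd
  have h := le_of_C_pow_dvd_charGenerator κ W hp5 hκ C V hCV hgood hap hγ D hg (k := 1) (by rwa [pow_one])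
  rw [hSel, AddSubgroup.card_bot, padicValNat_one_right, padicValNat.eq_zero_of_not_dvd hTam] at h
  simp at h

end Twist

/-! ## §2 `η`-side: the same bound for every `η`-datum of `V` over an abstract `ℚ(μ_p)` -/

section Eta

variable (W : WeierstrassCurve ℚ) [W.IsElliptic] [W.IsGloballyMinimal] (p : ℕ) [hp : Fact p.Prime]

/-- **`pᵏ ∣ char(X⁺(V/K_∞)^η) ⟹ k ≤ ord_p #Sel_{p^∞}(W/ℚ) + ord_p Tam(W)`** for EVERY `η`-signed plus
dual datum `D'` of `V` over an abstract `K₀ = ℚ(μ_p)` (`ηq` the quadratic character, `κ` cyclotomic,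
`γ ∈ Gal(ℚ̄/K₀)` a topological generator) and every generator `g` of `Char(D'.X)` — `W` globally
minimal, `p ≥ 5`, `V` a globally minimal model of `W^{(p*)}` good at `p` with `a_p(V) = 0`,
`Sel_{p^∞}(W/ℚ)` finite: ctrl g4's (D5⁺)⁻¹ (`exists_strictSignedSelmerDualData_one_of_eta`, same
characteristic ideal) + §1. I.e. **`μ(X⁺(V/K_∞)^η) ≤ ord_p(#Ш(W)[p^∞]·Tam(W))` in analytic rank `0`**:
the integer `n` of Kobayashi's Thm. 4.1 at `η` ("`Char ⊇ (pⁿ L_p⁺(V,η,X))`") that the even main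
conjecture has to absorb off the onto locus is bounded by the bottom layer; Poitou–Tate-free, image-free.
[cite: Kobayashi2003, Thm. 4.1 (p. 8), §4 p. 8 (X⁺(E/K_∞)^η), Thm. 9.3 with (9.33)]
[cite: GreenbergVatsal2000, p. 2 (2)] [cite: GreenbergLNM1716, §4 Lemma 4.2 (p. 102)] -/
theorem eta_le_of_C_pow_dvd_charGenerator
    (V : WeierstrassCurve ℚ) [V.IsElliptic] [V.IsGloballyMinimal] (C : VariableChange ℚ)
    (hp5 : 5 ≤ p) (hCV : C • W.quadraticTwist ((-1) ^ (p / 2) * p) = V)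
    (hgood : V.HasGoodReductionAtPrime p) (hap : V.frobeniusTrace p = 0)
    [Finite ↥(W.selmerGroupPInfty p)]
    (K₀ : Type) [Field K₀] [NumberField K₀] [IsCyclotomicExtension {p} ℚ K₀]
    [(galRange (K := ℚ) K₀).Normal] (ηq : absoluteGaloisGroup ℚ →* ℤˣ)
    (hηK : ∀ σ ∈ galRange (K := ℚ) K₀, ηq σ = 1) (hη1 : ηq ≠ 1)
    {κ : ZpExtension ℚ p} {γ : absoluteGaloisGroup ℚ} (hκ : κ.IsCyclotomic) (hγ : κ.IsTopGenerator γ)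
    (hγK : γ ∈ galRange (K := ℚ) K₀) (D' : EtaSignedSelmerDualData V κ K₀ ℚ_[p] ηq γ 1)
    {g : IwasawaAlgebra p} (hg : D'.charIdeal = Ideal.span {g}) {k : ℕ}
    (hk : PowerSeries.C ((p : ℤ_[p]) ^ k) ∣ g) :
    (k : ℤ) ≤ (padicValNat p (Nat.card ↥(W.selmerGroupPInfty p)) : ℤ) + padicValNat p W.tamagawaProduct := by
  have hp2 : p ≠ 2 := by omega
  -- the dictionary data at the abstract `K₀ = ℚ(μ_p)`: `θ² = p*`, `ηq` = the sign character of `θ`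
  obtain ⟨θ, hθ2⟩ := exists_sq_eq_pStar p K₀ hp2
  have hc : θ ^ 2 = algebraMap ℚ K₀ ((-1) ^ (p / 2) * p) := by
    rw [hθ2, map_mul, map_pow, map_neg, map_one, map_natCast]
  have hθ : θ ∉ Set.range (algebraMap ℚ K₀) := by
    rintro ⟨q, hq⟩
    apply forall_sq_ne_pStar p q
    apply (algebraMap ℚ K₀).injective
    rw [map_pow, hq, hc]
  have hη := eta_eq_one_iff_smul_rootInClosure p K₀ hθ hc ηq hηK hη1
  have hDloc := localTowerHyp_padic p κ K₀ hκ
  have hκ₀ := kappa_surjOn_galRange_cyclotomic κ K₀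
  have hcop := coprime_index_galRange_cyclotomic p K₀
  obtain ⟨D, -, -, hchar, -⟩ :=
    ConverseControl.exists_strictSignedSelmerDualData_one_of_eta W K₀ hθ hc p κ hCV ηq hη ℚ_[p] hDloc hκ₀
      hcop hγK D'
  exact le_of_C_pow_dvd_charGenerator κ W hp5 hκ C V hCV hgood hap hγ D (hchar.trans hg) hk

/-- **On the unit rows every `η`-datum has a characteristic generator of unit content** — exactly the
`μ = 0` binder `hμ` of `EtaMuSaturation.etaUpperIntegral_of_hasUnitContent` /
`…quadraticBranchPlusEtaMainConjectureAt_of_hasUnitContent_of_missingLowerBoundAt`, for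
`Sel_{p^∞}(W/ℚ) = 0` and `p ∤ Tam(W)` (so there the `μ`-road and the unit-row road of
`…PlusEtaNonsurjUnitRows` agree). [cite: GreenbergVatsal2000, p. 2 (2)] [cite: GreenbergLNM1716, §3 Prop. 3.8] -/
theorem eta_hasUnitContent_of_selmer_trivial_of_not_dvd_tamagawa
    (V : WeierstrassCurve ℚ) [V.IsElliptic] [V.IsGloballyMinimal] (C : VariableChange ℚ)
    (hp5 : 5 ≤ p) (hCV : C • W.quadraticTwist ((-1) ^ (p / 2) * p) = V)
    (hgood : V.HasGoodReductionAtPrime p) (hap : V.frobeniusTrace p = 0)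
    (hSel : W.selmerGroupPInfty p = ⊥) (hTam : ¬ p ∣ W.tamagawaProduct) :
    ∀ (K₀ : Type) [Field K₀] [NumberField K₀] [IsCyclotomicExtension {p} ℚ K₀]
        [(galRange (K := ℚ) K₀).Normal] (ηq : absoluteGaloisGroup ℚ →* ℤˣ),
        (∀ σ ∈ galRange (K := ℚ) K₀, ηq σ = 1) → ηq ≠ 1 →
      ∀ (κ : ZpExtension ℚ p) (γ : absoluteGaloisGroup ℚ),
        κ.IsCyclotomic → κ.IsTopGenerator γ → γ ∈ galRange (K := ℚ) K₀ →
      ∀ (D : EtaSignedSelmerDualData V κ K₀ ℚ_[p] ηq γ 1) (g : IwasawaAlgebra p),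
        D.charIdeal = Ideal.span {g} → HasUnitContent g := by
  intro K₀ _ _ _ _ ηq hηK hη1 κ γ hκ hγ hγK D' g hg
  haveI : Finite ↥(W.selmerGroupPInfty p) := by rw [hSel]; infer_instance
  rw [hasUnitContent_iff_not_C_dvd]
  intro hdvd
  have h := eta_le_of_C_pow_dvd_charGenerator W p V C hp5 hCV hgood hap K₀ ηq hηK hη1 hκ hγ hγK D' hg
    (k := 1) (by rwa [pow_one])
  rw [hSel, AddSubgroup.card_bot, padicValNat_one_right, padicValNat.eq_zero_of_not_dvd hTam] at h
  simp at h

end Eta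


end EtaMuBound

end Summit.BirchSwinnertonDyer.BirchSwinnertonDyer.Theorems

end
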